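import Mathlib
import Summits.ValiantsHypothesis.ValiantsHypothesis.Theses.ValuativeGCT
import Summits.ValiantsHypothesis.ValiantsHypothesis.Theorems.ValuativeGCTValuativeFlipSuccTransfer
import Summits.ValiantsHypothesis.ValiantsHypothesis.Theorems.ValuativeGCTValuativeFlipHeadSqrtTwo

/-!
# The crux as a position-dependent `m ↦ m + 1` step transfer, and where the step breaks
# (crux `ValuativeGCT.ValuativeFlip`, stmt-ValiantsHypothesis-12624; wall-breaker axis k8
# "representation-stability transfer between `m` and `m + 1`", closing file of the axis)

Write `FlipBody(n, m)` for the body of the route decl `ValuativeGCT.ValuativeFlip` at the window position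
`(n, m)` (some admissible centre `(U, r)`, degree `δ`, shape `λ ⊢ mδ` with
`dim T_U(λ) < mult_{λ*} ℂ[Δ_m(X₀₀^{m-n} per_n)]`; written out verbatim below, as everywhere in this crux).
The axis asked whether the flip can be TRANSPORTED from level `m` to level `m + 1`.  State of the tree
when this file was written (all landed by the sibling seats k4/k8/k12/k16 of the axis): every monotone
transfer of either SIDE of the body is a theorem (inner monotonicity `flipBody_mono_inner`, anchored rays
`perAnchorInheritance_every`, diagonals `orbitMultiplicity_paddedPer_le_diag`, fresh letters
`orbitMultiplicity_le_rowLift_fresh_padding`, det side `det_everyStepMonotone`, ray stability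
`rayStability_chain`), both sides are co-monotone along every such move, and the flip PREDICATE itself is
not monotone in `m` (`exists_flip_not_succ`: for every `n ≥ 3` the step `m ↦ m + 1` fails somewhere in
`n ≤ m ≤ 2ⁿ - 2`, because the bottom `m = n` flips and Grenet's level `m = 2ⁿ - 1` does not).

This file records the END STATE of the axis as three statements of pure logic over landed theorems:

* `flipBody_of_stepTransfer_upTo` — a step transfer valid on an initial segment `n ≤ m < L` carries the
  bottom flip (`valuativeFlip_cruxBody_bottom`) to every `n ≤ k ≤ L` (the ceiling-`L` form of
  `flipBody_of_uniform_succTransfer`, which is the case `L = 2ⁿ - 1`);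
* `valuativeFlip_iff_windowStepTransfer` — **the crux IS the position-dependent step transfer inside its
  own window**: `ValuativeFlip ↔ ∀ c, ∃ n₀, ∀ n ≥ n₀, ∀ m, n ≤ m → m + 1 ≤ 2^((log₂ n + c)^c) →
  (FlipBody(n, m) → FlipBody(n, m + 1))`.  So "representation-stability transfer between `m` and `m + 1`"
  is not an approach to the crux but a normal form of it: the transfer must hold exactly up to the
  quasi-polynomial ceiling and (by `exists_flip_not_succ`) provably fails below the exponential one;
* `exists_stepBreak_above_sqrt2`, `exists_stepBreak_above_slope` — **the first failure of the step lies in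
  the TAIL**: since the head of the window flips at every slope below `√2` (`headFlipBody_sqrt2_uniform`,
  `headFlipBody_of_sq_lt_two`, line `four-row-count`), for every `n ≥ 32` there is a level `m` with
  `2n² < (m + 14)²`, `m + 2 ≤ 2ⁿ`, `FlipBody(n, m)` and `¬ FlipBody(n, m + 1)`; and for every rational slope
  `a/b < √2`, eventually in `n`, such an `m` with `a·n < b·(m + 1)`.  Equivalently
  (`not_stepTransfer_on_tail_range`): even restricted to the tail range `(m + 14)² > 2n²` the step transfer
  cannot hold uniformly up to `2ⁿ - 2`.  The exact location of the first break `m⋆(n)` is the content of the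
  crux: `ValuativeFlip ⇔ m⋆(n)` is super-quasi-polynomial, `HeadFlip` gives `m⋆(n) ≥ √2·n - 14`, Grenet gives
  `m⋆(n) ≤ 2ⁿ - 2`.

Sources: this crux's `Cruxes/ValuativeFlip/AxisK12SizeTransfer.md`, `AxisK12G1PaddingNonMonotone.md`,
`AxisK4G1S3Closure.md`, `AxisK16G1TailSuffices.md` (the transfer table); K. Mulmuley, M. Sohoni, SIAM J.
Comput. 31 (2001) §4; B. Grenet (2011); BLMW, SIAM J. Comput. 40 (2011) §5–6; T. Church, J. Ellenberg,
B. Farb, Duke Math. J. 164 (2015) (the heuristic under test). [this crux; new]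
-/

set_option linter.dupNamespace false

namespace Summit.ValiantsHypothesis.ValiantsHypothesis.Theorems.ValuativeFlip

open scoped BigOperators Matrix
open Literature.NumberTheory.DiophantineGeometry
open Literature.Computability.AlgebraicComplexity
open Summit.ValiantsHypothesis.ValiantsHypothesis.Theses.ValuativeGCT
open Summit.ValiantsHypothesis.ValiantsHypothesis.Theorems.NoValuativeFlip
open Summit.ValiantsHypothesis.ValiantsHypothesis.Theorems.ValuativeBound

noncomputable section

/-- **Step transfer with a ceiling.**  If the body of `ValuativeFlip` passes from `m` to `m + 1` at every
`n ≤ m` with `m + 1 ≤ L` (`n ≥ 3`), then it holds at every `n ≤ k ≤ L` — induction from the bottom flip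
`valuativeFlip_cruxBody_bottom` (Hilbert-function count at `m = n`).  The case `L = 2ⁿ - 1` is
`flipBody_of_uniform_succTransfer`. [this file] -/
theorem flipBody_of_stepTransfer_upTo (n : ℕ) (hn : 3 ≤ n) (L : ℕ)
    (H : ∀ (m : ℕ) [NeZero m], n ≤ m → m + 1 ≤ L →
      (∃ (U : Submodule ℂ (MatIdx m → ℂ)) (r δ : ℕ) (lam : Nat.Partition (m * δ)), (∀ u ∈ U, (Matrix.of fun a b : Fin m => u (toLex (a, b))).rank ≤ r) ∧ lam.parts.card ≤ m * m ∧ Module.finrank ℂ ↥(MvPolynomial.homogeneousSubmodule (MatIdx m × MatIdx m) ℂ (m * δ) ⊓ ((MvPolynomial.vanishingIdeal ℂ {p : MatIdx m × MatIdx m → ℂ | ∀ j : MatIdx m, (fun i => p (j, i)) ∈ U}) ^ (δ * (m - r))).restrictScalars ℂ ⊓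
            (⨅ (M : Matrix (MatIdx m) (MatIdx m) ℂ) (_ : linSubst (MatIdx m) ℂ M (detFormLex ℂ m) = detFormLex ℂ m), LinearMap.ker ((MvPolynomial.aeval fun p : MatIdx m × MatIdx m => ∑ l : MatIdx m, M l p.2 • (MvPolynomial.X (p.1, l) : MvPolynomial (MatIdx m × MatIdx m) ℂ)).toLinearMap - (LinearMap.id : MvPolynomial (MatIdx m × MatIdx m) ℂ →ₗ[ℂ] MvPolynomial (MatIdx m × MatIdx m) ℂ))) ⊓
            (⨅ (g : Matrix.GeneralLinearGroup (MatIdx m) ℂ) (_ : IsUpperTriangular g), LinearMap.ker ((MvPolynomial.aeval fun p : MatIdx m × MatIdx m => ∑ l : MatIdx m, ((g⁻¹ : Matrix.GeneralLinearGroup (MatIdx m) ℂ) : Matrix (MatIdx m) (MatIdx m) ℂ) p.1 l • (MvPolynomial.X (l, p.2) : MvPolynomial (MatIdx m × MatIdx m) ℂ)).toLinearMap - weightChar ((Weight.dualOfPartition (m * m) lam).toMatIdx : Weight (MatIdx m)) g • (LinearMap.id : MvPolynomial (MatIdx m × MatIdx m) ℂ →ₗ[ℂ] MvPolynomial (MatIdx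 m × MatIdx m) ℂ))))
          < orbitMultiplicity ℂ (paddedPerFormLex ℂ n m) m ((Weight.dualOfPartition (m * m) lam).toMatIdx : Weight (MatIdx m))) →
      (∃ (U : Submodule ℂ (MatIdx (m + 1) → ℂ)) (r δ : ℕ) (lam : Nat.Partition ((m + 1) * δ)), (∀ u ∈ U, (Matrix.of fun a b : Fin (m + 1) => u (toLex (a, b))).rank ≤ r) ∧ lam.parts.card ≤ (m + 1) * (m + 1) ∧ Module.finrank ℂ ↥(MvPolynomial.homogeneousSubmodule (MatIdx (m + 1) × MatIdx (m + 1)) ℂ ((m + 1) * δ) ⊓ ((MvPolynomial.vanishingIdeal ℂ {p : MatIdx (m + 1) × MatIdx (m + 1) → ℂ | ∀ j : MatIdx (m + 1), (fun i => p (j, i)) ∈ U}) ^ (δ * ((m + 1) - r))).restrictScalars ℂ ⊓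
            (⨅ (M : Matrix (MatIdx (m + 1)) (MatIdx (m + 1)) ℂ) (_ : linSubst (MatIdx (m + 1)) ℂ M (detFormLex ℂ (m + 1)) = detFormLex ℂ (m + 1)), LinearMap.ker ((MvPolynomial.aeval fun p : MatIdx (m + 1) × MatIdx (m + 1) => ∑ l : MatIdx (m + 1), M l p.2 • (MvPolynomial.X (p.1, l) : MvPolynomial (MatIdx (m + 1) × MatIdx (m + 1)) ℂ)).toLinearMap - (LinearMap.id : MvPolynomial (MatIdx (m + 1) × MatIdx (m + 1)) ℂ →ₗ[ℂ] MvPolynomial (MatIdx (m + 1) × MatIdx (m + 1)) ℂ))) ⊓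
            (⨅ (g : Matrix.GeneralLinearGroup (MatIdx (m + 1)) ℂ) (_ : IsUpperTriangular g), LinearMap.ker ((MvPolynomial.aeval fun p : MatIdx (m + 1) × MatIdx (m + 1) => ∑ l : MatIdx (m + 1), ((g⁻¹ : Matrix.GeneralLinearGroup (MatIdx (m + 1)) ℂ) : Matrix (MatIdx (m + 1)) (MatIdx (m + 1)) ℂ) p.1 l • (MvPolynomial.X (l, p.2) : MvPolynomial (MatIdx (m + 1) × MatIdx (m + 1)) ℂ)).toLinearMap - weightChar ((Weight.dualOfPartition ((m + 1) * (m + 1)) lam).toMatIdx : Weight (MatIdx (m + 1))) g • (LinearMap.id : MvPolynomial (MatIdx (m + 1) × MatIdx (m + 1)) ℂ →ₗ[ℂ] MvPolynomial (MatIdx (m + 1) × MatIdx (m + 1)) ℂ))))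
          < orbitMultiplicity ℂ (paddedPerFormLex ℂ n (m + 1)) (m + 1) ((Weight.dualOfPartition ((m + 1) * (m + 1)) lam).toMatIdx : Weight (MatIdx (m + 1))))) :
    ∀ (k : ℕ) [NeZero k], n ≤ k → k ≤ L →
      (∃ (U : Submodule ℂ (MatIdx k → ℂ)) (r δ : ℕ) (lam : Nat.Partition (k * δ)), (∀ u ∈ U, (Matrix.of fun a b : Fin k => u (toLex (a, b))).rank ≤ r) ∧ lam.parts.card ≤ k * k ∧ Module.finrank ℂ ↥(MvPolynomial.homogeneousSubmodule (MatIdx k × MatIdx k) ℂ (k * δ) ⊓ ((MvPolynomial.vanishingIdeal ℂ {p : MatIdx k × MatIdx k → ℂ | ∀ j : MatIdx k, (fun i => p (j, i)) ∈ U}) ^ (δ * (k - r))).restrictScalars ℂ ⊓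
            (⨅ (M : Matrix (MatIdx k) (MatIdx k) ℂ) (_ : linSubst (MatIdx k) ℂ M (detFormLex ℂ k) = detFormLex ℂ k), LinearMap.ker ((MvPolynomial.aeval fun p : MatIdx k × MatIdx k => ∑ l : MatIdx k, M l p.2 • (MvPolynomial.X (p.1, l) : MvPolynomial (MatIdx k × MatIdx k) ℂ)).toLinearMap - (LinearMap.id : MvPolynomial (MatIdx k × MatIdx k) ℂ →ₗ[ℂ] MvPolynomial (MatIdx k × MatIdx k) ℂ))) ⊓
            (⨅ (g : Matrix.GeneralLinearGroup (MatIdx k) ℂ) (_ : IsUpperTriangular g), LinearMap.ker ((MvPolynomial.aeval fun p : MatIdx k × MatIdx k => ∑ l : MatIdx k, ((g⁻¹ : Matrix.GeneralLinearGroup (MatIdx k) ℂ) : Matrix (MatIdx k) (MatIdx k) ℂ) p.1 l • (MvPolynomial.X (l, p.2) : MvPolynomial (MatIdx k × MatIdx k) ℂ)).toLinearMap - weightChar ((Weight.dualOfPartition (k * k) lam).toMatIdx : Weight (MatIdx k)) g • (LinearMap.id : MvPolynomial (MatIdx k × MatIdx k) ℂ →ₗ[ℂ] MvPolynomial (MatIdx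 k × MatIdx k) ℂ))))
          < orbitMultiplicity ℂ (paddedPerFormLex ℂ n k) k ((Weight.dualOfPartition (k * k) lam).toMatIdx : Weight (MatIdx k))) := by
  intro k inst hnk
  revert inst
  induction k, hnk using Nat.le_induction with
  | base =>
    intro _ _
    exact valuativeFlip_cruxBody_bottom n hn
  | succ k hnk ih =>
    intro _ hk
    haveI hk0 : NeZero k := ⟨by omega⟩
    exact H k hnk (by omega) (ih (by omega))

/-- **The crux is the step transfer inside its window.**  `ValuativeGCT.ValuativeFlip` (flips at EVERY
position `n ≤ m ≤ 2^((log₂ n + c)^c)`, eventually in `n`, for every `c`) is EQUIVALENT to the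
position-dependent representation-stability statement "eventually in `n`, the flip body passes from `m` to
`m + 1` whenever `m + 1` is still inside the window": `→` is trivial (the conclusion holds outright), `←` is
induction from the bottom flip (`flipBody_of_stepTransfer_upTo` with ceiling `2^((log₂ n + c)^c)`).  Compare
`not_uniform_succTransfer` / `exists_flip_not_succ`: with the exponential ceiling `2ⁿ - 1` the same transfer
is FALSE for every `n ≥ 3`. [this file] -/
theorem valuativeFlip_iff_windowStepTransfer :
    ValuativeFlip ↔
      ∀ c : ℕ, ∃ n₀ : ℕ, ∀ n ≥ n₀, ∀ (m : ℕ) [NeZero m], n ≤ m → m + 1 ≤ 2 ^ ((Nat.log 2 n + c) ^ c) →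
        (∃ (U : Submodule ℂ (MatIdx m → ℂ)) (r δ : ℕ) (lam : Nat.Partition (m * δ)), (∀ u ∈ U, (Matrix.of fun a b : Fin m => u (toLex (a, b))).rank ≤ r) ∧ lam.parts.card ≤ m * m ∧ Module.finrank ℂ ↥(MvPolynomial.homogeneousSubmodule (MatIdx m × MatIdx m) ℂ (m * δ) ⊓ ((MvPolynomial.vanishingIdeal ℂ {p : MatIdx m × MatIdx m → ℂ | ∀ j : MatIdx m, (fun i => p (j, i)) ∈ U}) ^ (δ * (m - r))).restrictScalars ℂ ⊓
            (⨅ (M : Matrix (MatIdx m) (MatIdx m) ℂ) (_ : linSubst (MatIdx m) ℂ M (detFormLex ℂ m) = detFormLex ℂ m), LinearMap.ker ((MvPolynomial.aeval fun p : MatIdx m × MatIdx m => ∑ l : MatIdx m, M l p.2 • (MvPolynomial.X (p.1, l) : MvPolynomial (MatIdx m × MatIdx m) ℂ)).toLinearMap - (LinearMap.id : MvPolynomial (MatIdx m × MatIdx m) ℂ →ₗ[ℂ] MvPolynomial (MatIdx m × MatIdx m) ℂ))) ⊓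
            (⨅ (g : Matrix.GeneralLinearGroup (MatIdx m) ℂ) (_ : IsUpperTriangular g), LinearMap.ker ((MvPolynomial.aeval fun p : MatIdx m × MatIdx m => ∑ l : MatIdx m, ((g⁻¹ : Matrix.GeneralLinearGroup (MatIdx m) ℂ) : Matrix (MatIdx m) (MatIdx m) ℂ) p.1 l • (MvPolynomial.X (l, p.2) : MvPolynomial (MatIdx m × MatIdx m) ℂ)).toLinearMap - weightChar ((Weight.dualOfPartition (m * m) lam).toMatIdx : Weight (MatIdx m)) g • (LinearMap.id : MvPolynomial (MatIdx m × MatIdx m) ℂ →ₗ[ℂ] MvPolynomial (MatIdx m × MatIdx m) ℂ))))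
          < orbitMultiplicity ℂ (paddedPerFormLex ℂ n m) m ((Weight.dualOfPartition (m * m) lam).toMatIdx : Weight (MatIdx m))) →
        (∃ (U : Submodule ℂ (MatIdx (m + 1) → ℂ)) (r δ : ℕ) (lam : Nat.Partition ((m + 1) * δ)), (∀ u ∈ U, (Matrix.of fun a b : Fin (m + 1) => u (toLex (a, b))).rank ≤ r) ∧ lam.parts.card ≤ (m + 1) * (m + 1) ∧ Module.finrank ℂ ↥(MvPolynomial.homogeneousSubmodule (MatIdx (m + 1) × MatIdx (m + 1)) ℂ ((m + 1) * δ) ⊓ ((MvPolynomial.vanishingIdeal ℂ {p : MatIdx (m + 1) × MatIdx (m + 1) → ℂ | ∀ j : MatIdx (m + 1), (fun i => p (j, i)) ∈ U}) ^ (δ * ((m + 1) - r))).restrictScalars ℂ ⊓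
            (⨅ (M : Matrix (MatIdx (m + 1)) (MatIdx (m + 1)) ℂ) (_ : linSubst (MatIdx (m + 1)) ℂ M (detFormLex ℂ (m + 1)) = detFormLex ℂ (m + 1)), LinearMap.ker ((MvPolynomial.aeval fun p : MatIdx (m + 1) × MatIdx (m + 1) => ∑ l : MatIdx (m + 1), M l p.2 • (MvPolynomial.X (p.1, l) : MvPolynomial (MatIdx (m + 1) × MatIdx (m + 1)) ℂ)).toLinearMap - (LinearMap.id : MvPolynomial (MatIdx (m + 1) × MatIdx (m + 1)) ℂ →ₗ[ℂ] MvPolynomial (MatIdx (m + 1) × MatIdx (m + 1)) ℂ))) ⊓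
            (⨅ (g : Matrix.GeneralLinearGroup (MatIdx (m + 1)) ℂ) (_ : IsUpperTriangular g), LinearMap.ker ((MvPolynomial.aeval fun p : MatIdx (m + 1) × MatIdx (m + 1) => ∑ l : MatIdx (m + 1), ((g⁻¹ : Matrix.GeneralLinearGroup (MatIdx (m + 1)) ℂ) : Matrix (MatIdx (m + 1)) (MatIdx (m + 1)) ℂ) p.1 l • (MvPolynomial.X (l, p.2) : MvPolynomial (MatIdx (m + 1) × MatIdx (m + 1)) ℂ)).toLinearMap - weightChar ((Weight.dualOfPartition ((m + 1) * (m + 1)) lam).toMatIdx : Weight (MatIdx (m + 1))) g • (LinearMap.id : MvPolynomial (MatIdx (m + 1) × MatIdx (m + 1)) ℂ →ₗ[ℂ] MvPolynomial (MatIdx (m + 1) × MatIdx (m + 1)) ℂ))))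
          < orbitMultiplicity ℂ (paddedPerFormLex ℂ n (m + 1)) (m + 1) ((Weight.dualOfPartition ((m + 1) * (m + 1)) lam).toMatIdx : Weight (MatIdx (m + 1)))) := by
  constructor
  · intro hVF c
    obtain ⟨n₀, hn₀⟩ := hVF c
    refine ⟨n₀, fun n hn m _ hnm hm _ => ?_⟩
    exact hn₀ n hn (m + 1) (by omega) hm
  · intro H c
    obtain ⟨n₀, hn₀⟩ := H c
    refine ⟨max n₀ 3, fun n hn m inst hnm hm => ?_⟩
    have hn0 : n₀ ≤ n := le_of_max_le_left hn
    have hn3 : 3 ≤ n := le_of_max_le_right hn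
    exact flipBody_of_stepTransfer_upTo n hn3 (2 ^ ((Nat.log 2 n + c) ^ c))
      (fun m' _ hnm' hm' hb => hn₀ n hn0 m' hnm' hm' hb) m hnm hm

/-- **The step breaks in the tail (uniform form).**  For every `n ≥ 32` there is a level `m` with
`n ≤ m`, `m + 2 ≤ 2ⁿ` and `2n² < (m + 14)²` — i.e. `m + 1` lies ABOVE the uniform `√2`-head
`(m' + 13)² ≤ 2n²` of `headFlipBody_sqrt2_uniform` — at which the body of `ValuativeFlip` HOLDS while it
FAILS at `m + 1`.  Proof: the least level `m₁ ≥ n` without a flip exists (Grenet's level `2ⁿ - 1` has none: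
`noValuativeFlip_body_of_two_pow_le` with the proved `ValuativeBound`), is not `n` (bottom flip), and is not
inside the uniform head; take `m = m₁ - 1`.  So the first failure `m⋆(n)` of the `m ↦ m + 1` transfer
satisfies `√2·n - 14 < m⋆(n) ≤ 2ⁿ - 2`; the crux asks for `m⋆(n) > 2^((log₂ n + c)^c)`. [this file; new] -/
theorem exists_stepBreak_above_sqrt2 (n : ℕ) (hn : 32 ≤ n) :
    ∃ (m : ℕ) (_ : NeZero m), n ≤ m ∧ m + 2 ≤ 2 ^ n ∧ 2 * n ^ 2 < (m + 14) ^ 2 ∧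
      (∃ (U : Submodule ℂ (MatIdx m → ℂ)) (r δ : ℕ) (lam : Nat.Partition (m * δ)), (∀ u ∈ U, (Matrix.of fun a b : Fin m => u (toLex (a, b))).rank ≤ r) ∧ lam.parts.card ≤ m * m ∧ Module.finrank ℂ ↥(MvPolynomial.homogeneousSubmodule (MatIdx m × MatIdx m) ℂ (m * δ) ⊓ ((MvPolynomial.vanishingIdeal ℂ {p : MatIdx m × MatIdx m → ℂ | ∀ j : MatIdx m, (fun i => p (j, i)) ∈ U}) ^ (δ * (m - r))).restrictScalars ℂ ⊓
            (⨅ (M : Matrix (MatIdx m) (MatIdx m) ℂ) (_ : linSubst (MatIdx m) ℂ M (detFormLex ℂ m) = detFormLex ℂ m), LinearMap.ker ((MvPolynomial.aeval fun p : MatIdx m × MatIdx m => ∑ l : MatIdx m, M l p.2 • (MvPolynomial.X (p.1, l) : MvPolynomial (MatIdx m × MatIdx m) ℂ)).toLinearMap - (LinearMap.id : MvPolynomial (MatIdx m × MatIdx m) ℂ →ₗ[ℂ] MvPolynomial (MatIdx m × MatIdx m) ℂ))) ⊓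
            (⨅ (g : Matrix.GeneralLinearGroup (MatIdx m) ℂ) (_ : IsUpperTriangular g), LinearMap.ker ((MvPolynomial.aeval fun p : MatIdx m × MatIdx m => ∑ l : MatIdx m, ((g⁻¹ : Matrix.GeneralLinearGroup (MatIdx m) ℂ) : Matrix (MatIdx m) (MatIdx m) ℂ) p.1 l • (MvPolynomial.X (l, p.2) : MvPolynomial (MatIdx m × MatIdx m) ℂ)).toLinearMap - weightChar ((Weight.dualOfPartition (m * m) lam).toMatIdx : Weight (MatIdx m)) g • (LinearMap.id : MvPolynomial (MatIdx m × MatIdx m) ℂ →ₗ[ℂ] MvPolynomial (MatIdx m × MatIdx m) ℂ))))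
          < orbitMultiplicity ℂ (paddedPerFormLex ℂ n m) m ((Weight.dualOfPartition (m * m) lam).toMatIdx : Weight (MatIdx m))) ∧
      ¬ (∃ (U : Submodule ℂ (MatIdx (m + 1) → ℂ)) (r δ : ℕ) (lam : Nat.Partition ((m + 1) * δ)), (∀ u ∈ U, (Matrix.of fun a b : Fin (m + 1) => u (toLex (a, b))).rank ≤ r) ∧ lam.parts.card ≤ (m + 1) * (m + 1) ∧ Module.finrank ℂ ↥(MvPolynomial.homogeneousSubmodule (MatIdx (m + 1) × MatIdx (m + 1)) ℂ ((m + 1) * δ) ⊓ ((MvPolynomial.vanishingIdeal ℂ {p : MatIdx (m + 1) × MatIdx (m + 1) → ℂ | ∀ j : MatIdx (m + 1), (fun i => p (j, i)) ∈ U}) ^ (δ * ((m + 1) - r))).restrictScalars ℂ ⊓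
            (⨅ (M : Matrix (MatIdx (m + 1)) (MatIdx (m + 1)) ℂ) (_ : linSubst (MatIdx (m + 1)) ℂ M (detFormLex ℂ (m + 1)) = detFormLex ℂ (m + 1)), LinearMap.ker ((MvPolynomial.aeval fun p : MatIdx (m + 1) × MatIdx (m + 1) => ∑ l : MatIdx (m + 1), M l p.2 • (MvPolynomial.X (p.1, l) : MvPolynomial (MatIdx (m + 1) × MatIdx (m + 1)) ℂ)).toLinearMap - (LinearMap.id : MvPolynomial (MatIdx (m + 1) × MatIdx (m + 1)) ℂ →ₗ[ℂ] MvPolynomial (MatIdx (m + 1) × MatIdx (m + 1)) ℂ))) ⊓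
            (⨅ (g : Matrix.GeneralLinearGroup (MatIdx (m + 1)) ℂ) (_ : IsUpperTriangular g), LinearMap.ker ((MvPolynomial.aeval fun p : MatIdx (m + 1) × MatIdx (m + 1) => ∑ l : MatIdx (m + 1), ((g⁻¹ : Matrix.GeneralLinearGroup (MatIdx (m + 1)) ℂ) : Matrix (MatIdx (m + 1)) (MatIdx (m + 1)) ℂ) p.1 l • (MvPolynomial.X (l, p.2) : MvPolynomial (MatIdx (m + 1) × MatIdx (m + 1)) ℂ)).toLinearMap - weightChar ((Weight.dualOfPartition ((m + 1) * (m + 1)) lam).toMatIdx : Weight (MatIdx (m + 1))) g • (LinearMap.id : MvPolynomial (MatIdx (m + 1) × MatIdx (m + 1)) ℂ →ₗ[ℂ] MvPolynomial (MatIdx (m + 1) × MatIdx (m + 1)) ℂ))))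
          < orbitMultiplicity ℂ (paddedPerFormLex ℂ n (m + 1)) (m + 1) ((Weight.dualOfPartition ((m + 1) * (m + 1)) lam).toMatIdx : Weight (MatIdx (m + 1)))) := by
  classical
  -- `Q m` : the flip body at level `m` (with its `NeZero` instance packaged)
  have h8 : 8 ≤ 2 ^ n := by
    calc 8 = 2 ^ 3 := by norm_num
      _ ≤ 2 ^ n := Nat.pow_le_pow_right (by norm_num) (by omega)
  have hlt2 : n < 2 ^ n := Nat.lt_two_pow_self
  -- a level without flip exists: Grenet's `2ⁿ - 1`
  have hex : ∃ m₁ : ℕ, n ≤ m₁ ∧ ¬ ∃ (_ : NeZero m₁), (∃ (U : Submodule ℂ (MatIdx m₁ → ℂ)) (r δ : ℕ) (lam : Nat.Partition (m₁ * δ)), (∀ u ∈ U, (Matrix.of fun a b : Fin m₁ => u (toLex (a, b))).rank ≤ r) ∧ lam.parts.card ≤ m₁ * m₁ ∧ Module.finrank ℂ ↥(MvPolynomial.homogeneousSubmodule (MatIdx m₁ × MatIdx m₁) ℂ (m₁ * δ) ⊓ ((MvPolynomial.vanishingIdeal ℂ {p : MatIdx m₁ × MatIdx m₁ → ℂ |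 ∀ j : MatIdx m₁, (fun i => p (j, i)) ∈ U}) ^ (δ * (m₁ - r))).restrictScalars ℂ ⊓
            (⨅ (M : Matrix (MatIdx m₁) (MatIdx m₁) ℂ) (_ : linSubst (MatIdx m₁) ℂ M (detFormLex ℂ m₁) = detFormLex ℂ m₁), LinearMap.ker ((MvPolynomial.aeval fun p : MatIdx m₁ × MatIdx m₁ => ∑ l : MatIdx m₁, M l p.2 • (MvPolynomial.X (p.1, l) : MvPolynomial (MatIdx m₁ × MatIdx m₁) ℂ)).toLinearMap - (LinearMap.id : MvPolynomial (MatIdx m₁ × MatIdx m₁) ℂ →ₗ[ℂ] MvPolynomial (MatIdx m₁ × MatIdx m₁) ℂ))) ⊓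
            (⨅ (g : Matrix.GeneralLinearGroup (MatIdx m₁) ℂ) (_ : IsUpperTriangular g), LinearMap.ker ((MvPolynomial.aeval fun p : MatIdx m₁ × MatIdx m₁ => ∑ l : MatIdx m₁, ((g⁻¹ : Matrix.GeneralLinearGroup (MatIdx m₁) ℂ) : Matrix (MatIdx m₁) (MatIdx m₁) ℂ) p.1 l • (MvPolynomial.X (l, p.2) : MvPolynomial (MatIdx m₁ × MatIdx m₁) ℂ)).toLinearMap - weightChar ((Weight.dualOfPartition (m₁ * m₁) lam).toMatIdx : Weight (MatIdx m₁)) g • (LinearMap.id : MvPolynomial (MatIdx m₁ × MatIdx m₁) ℂ →ₗ[ℂ] MvPolynomial (MatIdx m₁ × MatIdx m₁) ℂ))))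
          < orbitMultiplicity ℂ (paddedPerFormLex ℂ n m₁) m₁ ((Weight.dualOfPartition (m₁ * m₁) lam).toMatIdx : Weight (MatIdx m₁))) := by
    refine ⟨2 ^ n - 1, by omega, ?_⟩
    rintro ⟨inst, U, r, δ, lam, hU, hcard, hlt⟩
    have hle := noValuativeFlip_body_of_two_pow_le ValuativeBound_proof (n := n) (2 ^ n - 1) (by omega) U r hU δ lam hcard
    exact absurd hlt (not_lt.mpr hle)
  -- the least such level
  set m₁ := Nat.find hex with hm₁def
  have hm₁ : n ≤ m₁ ∧ ¬ ∃ (_ : NeZero m₁), (∃ (U : Submodule ℂ (MatIdx m₁ → ℂ)) (r δ : ℕ) (lam : Nat.Partition (m₁ * δ)), (∀ u ∈ U, (Matrix.of fun a b : Fin m₁ => u (toLex (a, b))).rank ≤ r) ∧ lam.parts.card ≤ m₁ * m₁ ∧ Module.finrank ℂ ↥(MvPolynomial.homogeneousSubmodule (MatIdx m₁ × MatIdx m₁) ℂ (m₁ * δ) ⊓ ((MvPolynomial.vanishingIdeal ℂ {p : MatIdx m₁ × MatIdx m₁ → ℂ | ∀ j : MatIdx m₁, (fun i => p (j, i)) ∈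 U}) ^ (δ * (m₁ - r))).restrictScalars ℂ ⊓
            (⨅ (M : Matrix (MatIdx m₁) (MatIdx m₁) ℂ) (_ : linSubst (MatIdx m₁) ℂ M (detFormLex ℂ m₁) = detFormLex ℂ m₁), LinearMap.ker ((MvPolynomial.aeval fun p : MatIdx m₁ × MatIdx m₁ => ∑ l : MatIdx m₁, M l p.2 • (MvPolynomial.X (p.1, l) : MvPolynomial (MatIdx m₁ × MatIdx m₁) ℂ)).toLinearMap - (LinearMap.id : MvPolynomial (MatIdx m₁ × MatIdx m₁) ℂ →ₗ[ℂ] MvPolynomial (MatIdx m₁ × MatIdx m₁) ℂ))) ⊓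
            (⨅ (g : Matrix.GeneralLinearGroup (MatIdx m₁) ℂ) (_ : IsUpperTriangular g), LinearMap.ker ((MvPolynomial.aeval fun p : MatIdx m₁ × MatIdx m₁ => ∑ l : MatIdx m₁, ((g⁻¹ : Matrix.GeneralLinearGroup (MatIdx m₁) ℂ) : Matrix (MatIdx m₁) (MatIdx m₁) ℂ) p.1 l • (MvPolynomial.X (l, p.2) : MvPolynomial (MatIdx m₁ × MatIdx m₁) ℂ)).toLinearMap - weightChar ((Weight.dualOfPartition (m₁ * m₁) lam).toMatIdx : Weight (MatIdx m₁)) g • (LinearMap.id : MvPolynomial (MatIdx m₁ × MatIdx m₁) ℂ →ₗ[ℂ] MvPolynomial (MatIdx m₁ × MatIdx m₁) ℂ))))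
          < orbitMultiplicity ℂ (paddedPerFormLex ℂ n m₁) m₁ ((Weight.dualOfPartition (m₁ * m₁) lam).toMatIdx : Weight (MatIdx m₁))) := Nat.find_spec hex
  have hm₁le : m₁ ≤ 2 ^ n - 1 := by
    refine Nat.find_min' hex ⟨by omega, ?_⟩
    rintro ⟨inst, U, r, δ, lam, hU, hcard, hlt⟩
    have hle := noValuativeFlip_body_of_two_pow_le ValuativeBound_proof (n := n) (2 ^ n - 1) (by omega) U r hU δ lam hcard
    exact absurd hlt (not_lt.mpr hle)
  have hmin : ∀ m' < m₁, n ≤ m' → ∃ (_ : NeZero m'), (∃ (U : Submodule ℂ (MatIdx m' → ℂ)) (r δ : ℕ) (lam : Nat.Partition (m' * δ)), (∀ u ∈ U, (Matrix.of fun a b : Fin m' => u (toLex (a, b))).rank ≤ r) ∧ lam.parts.card ≤ m' * m' ∧ Module.finrank ℂ ↥(MvPolynomial.homogeneousSubmodule (MatIdx m' × MatIdx m') ℂ (m' * δ) ⊓ ((MvPolynomial.vanishingIdeal ℂ {p : MatIdx m' × MatIdx m' → ℂ | ∀ j : MatIdx m', (fun i => p (j, i)) ∈ U}) ^ (δ *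 (m' - r))).restrictScalars ℂ ⊓
            (⨅ (M : Matrix (MatIdx m') (MatIdx m') ℂ) (_ : linSubst (MatIdx m') ℂ M (detFormLex ℂ m') = detFormLex ℂ m'), LinearMap.ker ((MvPolynomial.aeval fun p : MatIdx m' × MatIdx m' => ∑ l : MatIdx m', M l p.2 • (MvPolynomial.X (p.1, l) : MvPolynomial (MatIdx m' × MatIdx m') ℂ)).toLinearMap - (LinearMap.id : MvPolynomial (MatIdx m' × MatIdx m') ℂ →ₗ[ℂ] MvPolynomial (MatIdx m' × MatIdx m') ℂ))) ⊓
            (⨅ (g : Matrix.GeneralLinearGroup (MatIdx m') ℂ) (_ : IsUpperTriangular g), LinearMap.ker ((MvPolynomial.aeval fun p : MatIdx m' × MatIdx m' => ∑ l : MatIdx m', ((g⁻¹ : Matrix.GeneralLinearGroup (MatIdx m') ℂ) : Matrix (MatIdx m') (MatIdx m') ℂ) p.1 l • (MvPolynomial.X (l, p.2) : MvPolynomial (MatIdx m' × MatIdx m') ℂ)).toLinearMap - weightChar ((Weight.dualOfPartition (m' * m') lam).toMatIdx : Weight (MatIdx m')) g • (LinearMap.id : MvPolynomial (MatIdx m'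 × MatIdx m') ℂ →ₗ[ℂ] MvPolynomial (MatIdx m' × MatIdx m') ℂ))))
          < orbitMultiplicity ℂ (paddedPerFormLex ℂ n m') m' ((Weight.dualOfPartition (m' * m') lam).toMatIdx : Weight (MatIdx m'))) := by
    intro m' hm' hnm'
    by_contra hno
    exact Nat.find_min hex hm' ⟨hnm', hno⟩
  -- `m₁` is above the uniform head: otherwise it would flip
  have hhead : 2 * n ^ 2 < (m₁ + 13) ^ 2 := by
    by_contra hle
    rw [not_lt] at hle
    haveI : NeZero m₁ := ⟨by omega⟩
    exact hm₁.2 ⟨inferInstance, headFlipBody_sqrt2_uniform n (by omega) m₁ hm₁.1 hle⟩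
  -- `m₁ ≠ n`: the bottom flips (here via the uniform head at `m = n`, valid for `n ≥ 32`)
  have hm₁n : n + 1 ≤ m₁ := by
    rcases Nat.lt_or_ge n m₁ with h | h
    · omega
    · exfalso
      have heq : m₁ = n := le_antisymm h hm₁.1
      have hsq : (n + 13) ^ 2 ≤ 2 * n ^ 2 := by nlinarith
      rw [heq] at hhead
      omega
  -- take `m = m₁ - 1`
  clear_value m₁
  obtain ⟨m, rfl⟩ : ∃ m, m₁ = m + 1 := ⟨m₁ - 1, by omega⟩
  obtain ⟨inst, hflip⟩ := hmin m (Nat.lt_succ_self m) (by omega)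
  refine ⟨m, inst, by omega, by omega, ?_, hflip, ?_⟩
  · simpa [show m + 14 = m + 1 + 13 by ring] using hhead
  · intro hb
    exact hm₁.2 ⟨⟨by omega⟩, hb⟩

/-- **The step breaks above every head slope `a/b < √2`.**  For `0 < b` and `a² < 2b²`, for all large `n`
there is a level `m` with `n ≤ m`, `m + 2 ≤ 2ⁿ` and `a·n < b·(m + 1)` (so `m + 1` is beyond the slope-`a/b`
head) at which the body of `ValuativeFlip` holds while it fails at `m + 1`: the least flip-free level above
`n` exists (Grenet), is not `n` (bottom flip, `n ≥ 3`) and is not in the head (`headFlipBody_of_sq_lt_two`).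
[this file; new] -/
theorem exists_stepBreak_above_slope (a b : ℕ) (hb : 0 < b) (hab : a ^ 2 < 2 * b ^ 2) :
    ∃ n₀ : ℕ, ∀ n ≥ n₀, ∃ (m : ℕ) (_ : NeZero m), n ≤ m ∧ m + 2 ≤ 2 ^ n ∧ a * n < b * (m + 1) ∧
      (∃ (U : Submodule ℂ (MatIdx m → ℂ)) (r δ : ℕ) (lam : Nat.Partition (m * δ)), (∀ u ∈ U, (Matrix.of fun a b : Fin m => u (toLex (a, b))).rank ≤ r) ∧ lam.parts.card ≤ m * m ∧ Module.finrank ℂ ↥(MvPolynomial.homogeneousSubmodule (MatIdx m × MatIdx m) ℂ (m * δ) ⊓ ((MvPolynomial.vanishingIdeal ℂ {p : MatIdx m × MatIdx m → ℂ | ∀ j : MatIdx m, (fun i => p (j, i)) ∈ U}) ^ (δ * (m - r))).restrictScalars ℂ ⊓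
            (⨅ (M : Matrix (MatIdx m) (MatIdx m) ℂ) (_ : linSubst (MatIdx m) ℂ M (detFormLex ℂ m) = detFormLex ℂ m), LinearMap.ker ((MvPolynomial.aeval fun p : MatIdx m × MatIdx m => ∑ l : MatIdx m, M l p.2 • (MvPolynomial.X (p.1, l) : MvPolynomial (MatIdx m × MatIdx m) ℂ)).toLinearMap - (LinearMap.id : MvPolynomial (MatIdx m × MatIdx m) ℂ →ₗ[ℂ] MvPolynomial (MatIdx m × MatIdx m) ℂ))) ⊓
            (⨅ (g : Matrix.GeneralLinearGroup (MatIdx m) ℂ) (_ : IsUpperTriangular g), LinearMap.ker ((MvPolynomial.aeval fun p : MatIdx m × MatIdx m => ∑ l : MatIdx m, ((g⁻¹ : Matrix.GeneralLinearGroup (MatIdx m) ℂ) : Matrix (MatIdx m) (MatIdx m) ℂ) p.1 l • (MvPolynomial.X (l, p.2) : MvPolynomial (MatIdx m × MatIdx m) ℂ)).toLinearMap - weightChar ((Weight.dualOfPartition (m * m) lam).toMatIdx : Weight (MatIdx m)) g • (LinearMap.id : MvPolynomial (MatIdx m × MatIdx m) ℂ →ₗ[ℂ] MvPolynomial (MatIdx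 m × MatIdx m) ℂ))))
          < orbitMultiplicity ℂ (paddedPerFormLex ℂ n m) m ((Weight.dualOfPartition (m * m) lam).toMatIdx : Weight (MatIdx m))) ∧
      ¬ (∃ (U : Submodule ℂ (MatIdx (m + 1) → ℂ)) (r δ : ℕ) (lam : Nat.Partition ((m + 1) * δ)), (∀ u ∈ U, (Matrix.of fun a b : Fin (m + 1) => u (toLex (a, b))).rank ≤ r) ∧ lam.parts.card ≤ (m + 1) * (m + 1) ∧ Module.finrank ℂ ↥(MvPolynomial.homogeneousSubmodule (MatIdx (m + 1) × MatIdx (m + 1)) ℂ ((m + 1) * δ) ⊓ ((MvPolynomial.vanishingIdeal ℂ {p : MatIdx (m + 1) × MatIdx (m + 1) → ℂ | ∀ j : MatIdx (m + 1), (fun i => p (j, i)) ∈ U}) ^ (δ * ((m + 1) - r))).restrictScalars ℂ ⊓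
            (⨅ (M : Matrix (MatIdx (m + 1)) (MatIdx (m + 1)) ℂ) (_ : linSubst (MatIdx (m + 1)) ℂ M (detFormLex ℂ (m + 1)) = detFormLex ℂ (m + 1)), LinearMap.ker ((MvPolynomial.aeval fun p : MatIdx (m + 1) × MatIdx (m + 1) => ∑ l : MatIdx (m + 1), M l p.2 • (MvPolynomial.X (p.1, l) : MvPolynomial (MatIdx (m + 1) × MatIdx (m + 1)) ℂ)).toLinearMap - (LinearMap.id : MvPolynomial (MatIdx (m + 1) × MatIdx (m + 1)) ℂ →ₗ[ℂ] MvPolynomial (MatIdx (m + 1) × MatIdx (m + 1)) ℂ))) ⊓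
            (⨅ (g : Matrix.GeneralLinearGroup (MatIdx (m + 1)) ℂ) (_ : IsUpperTriangular g), LinearMap.ker ((MvPolynomial.aeval fun p : MatIdx (m + 1) × MatIdx (m + 1) => ∑ l : MatIdx (m + 1), ((g⁻¹ : Matrix.GeneralLinearGroup (MatIdx (m + 1)) ℂ) : Matrix (MatIdx (m + 1)) (MatIdx (m + 1)) ℂ) p.1 l • (MvPolynomial.X (l, p.2) : MvPolynomial (MatIdx (m + 1) × MatIdx (m + 1)) ℂ)).toLinearMap - weightChar ((Weight.dualOfPartition ((m + 1) * (m + 1)) lam).toMatIdx : Weight (MatIdx (m + 1))) g • (LinearMap.id : MvPolynomial (MatIdx (m + 1) × MatIdx (m + 1)) ℂ →ₗ[ℂ] MvPolynomial (MatIdx (m + 1) × MatIdx (m + 1)) ℂ))))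
          < orbitMultiplicity ℂ (paddedPerFormLex ℂ n (m + 1)) (m + 1) ((Weight.dualOfPartition ((m + 1) * (m + 1)) lam).toMatIdx : Weight (MatIdx (m + 1)))) := by
  classical
  obtain ⟨n₁, hn₁⟩ := headFlipBody_of_sq_lt_two a b hb hab
  refine ⟨max n₁ 3, fun n hn => ?_⟩
  have hnn₁ : n₁ ≤ n := le_of_max_le_left hn
  have hn3 : 3 ≤ n := le_of_max_le_right hn
  have h8 : 8 ≤ 2 ^ n := by
    calc 8 = 2 ^ 3 := by norm_num
      _ ≤ 2 ^ n := Nat.pow_le_pow_right (by norm_num) hn3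
  have hlt2 : n < 2 ^ n := Nat.lt_two_pow_self
  have hex : ∃ m₁ : ℕ, n ≤ m₁ ∧ ¬ ∃ (_ : NeZero m₁), (∃ (U : Submodule ℂ (MatIdx m₁ → ℂ)) (r δ : ℕ) (lam : Nat.Partition (m₁ * δ)), (∀ u ∈ U, (Matrix.of fun a b : Fin m₁ => u (toLex (a, b))).rank ≤ r) ∧ lam.parts.card ≤ m₁ * m₁ ∧ Module.finrank ℂ ↥(MvPolynomial.homogeneousSubmodule (MatIdx m₁ × MatIdx m₁) ℂ (m₁ * δ) ⊓ ((MvPolynomial.vanishingIdeal ℂ {p : MatIdx m₁ × MatIdx m₁ → ℂ | ∀ j : MatIdx m₁, (fun i => p (j, i)) ∈ U}) ^ (δ * (m₁ - r))).restrictScalars ℂ ⊓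
            (⨅ (M : Matrix (MatIdx m₁) (MatIdx m₁) ℂ) (_ : linSubst (MatIdx m₁) ℂ M (detFormLex ℂ m₁) = detFormLex ℂ m₁), LinearMap.ker ((MvPolynomial.aeval fun p : MatIdx m₁ × MatIdx m₁ => ∑ l : MatIdx m₁, M l p.2 • (MvPolynomial.X (p.1, l) : MvPolynomial (MatIdx m₁ × MatIdx m₁) ℂ)).toLinearMap - (LinearMap.id : MvPolynomial (MatIdx m₁ × MatIdx m₁) ℂ →ₗ[ℂ] MvPolynomial (MatIdx m₁ × MatIdx m₁) ℂ))) ⊓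
            (⨅ (g : Matrix.GeneralLinearGroup (MatIdx m₁) ℂ) (_ : IsUpperTriangular g), LinearMap.ker ((MvPolynomial.aeval fun p : MatIdx m₁ × MatIdx m₁ => ∑ l : MatIdx m₁, ((g⁻¹ : Matrix.GeneralLinearGroup (MatIdx m₁) ℂ) : Matrix (MatIdx m₁) (MatIdx m₁) ℂ) p.1 l • (MvPolynomial.X (l, p.2) : MvPolynomial (MatIdx m₁ × MatIdx m₁) ℂ)).toLinearMap - weightChar ((Weight.dualOfPartition (m₁ * m₁) lam).toMatIdx : Weight (MatIdx m₁)) g • (LinearMap.id : MvPolynomial (MatIdx m₁ × MatIdx m₁) ℂ →ₗ[ℂ] MvPolynomial (MatIdx m₁ × MatIdx m₁) ℂ))))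
          < orbitMultiplicity ℂ (paddedPerFormLex ℂ n m₁) m₁ ((Weight.dualOfPartition (m₁ * m₁) lam).toMatIdx : Weight (MatIdx m₁))) := by
    refine ⟨2 ^ n - 1, by omega, ?_⟩
    rintro ⟨inst, U, r, δ, lam, hU, hcard, hlt⟩
    have hle := noValuativeFlip_body_of_two_pow_le ValuativeBound_proof (n := n) (2 ^ n - 1) (by omega) U r hU δ lam hcard
    exact absurd hlt (not_lt.mpr hle)
  set m₁ := Nat.find hex with hm₁def
  have hm₁ : n ≤ m₁ ∧ ¬ ∃ (_ : NeZero m₁), (∃ (U : Submodule ℂ (MatIdx m₁ → ℂ)) (r δ : ℕ) (lam : Nat.Partition (m₁ * δ)), (∀ u ∈ U, (Matrix.of fun a b : Fin m₁ => u (toLex (a, b))).rank ≤ r) ∧ lam.parts.card ≤ m₁ * m₁ ∧ Module.finrank ℂ ↥(MvPolynomial.homogeneousSubmodule (MatIdx m₁ × MatIdx m₁) ℂ (m₁ * δ) ⊓ ((MvPolynomial.vanishingIdeal ℂ {p : MatIdx m₁ × MatIdx m₁ → ℂ | ∀ j : MatIdx m₁, (fun i => p (j, i)) ∈ U}) ^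 (δ * (m₁ - r))).restrictScalars ℂ ⊓
            (⨅ (M : Matrix (MatIdx m₁) (MatIdx m₁) ℂ) (_ : linSubst (MatIdx m₁) ℂ M (detFormLex ℂ m₁) = detFormLex ℂ m₁), LinearMap.ker ((MvPolynomial.aeval fun p : MatIdx m₁ × MatIdx m₁ => ∑ l : MatIdx m₁, M l p.2 • (MvPolynomial.X (p.1, l) : MvPolynomial (MatIdx m₁ × MatIdx m₁) ℂ)).toLinearMap - (LinearMap.id : MvPolynomial (MatIdx m₁ × MatIdx m₁) ℂ →ₗ[ℂ] MvPolynomial (MatIdx m₁ × MatIdx m₁) ℂ))) ⊓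
            (⨅ (g : Matrix.GeneralLinearGroup (MatIdx m₁) ℂ) (_ : IsUpperTriangular g), LinearMap.ker ((MvPolynomial.aeval fun p : MatIdx m₁ × MatIdx m₁ => ∑ l : MatIdx m₁, ((g⁻¹ : Matrix.GeneralLinearGroup (MatIdx m₁) ℂ) : Matrix (MatIdx m₁) (MatIdx m₁) ℂ) p.1 l • (MvPolynomial.X (l, p.2) : MvPolynomial (MatIdx m₁ × MatIdx m₁) ℂ)).toLinearMap - weightChar ((Weight.dualOfPartition (m₁ * m₁) lam).toMatIdx : Weight (MatIdx m₁)) g • (LinearMap.id : MvPolynomial (MatIdx m₁ × MatIdx m₁) ℂ →ₗ[ℂ] MvPolynomial (MatIdx m₁ × MatIdx m₁) ℂ))))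
          < orbitMultiplicity ℂ (paddedPerFormLex ℂ n m₁) m₁ ((Weight.dualOfPartition (m₁ * m₁) lam).toMatIdx : Weight (MatIdx m₁))) := Nat.find_spec hex
  have hm₁le : m₁ ≤ 2 ^ n - 1 := by
    refine Nat.find_min' hex ⟨by omega, ?_⟩
    rintro ⟨inst, U, r, δ, lam, hU, hcard, hlt⟩
    have hle := noValuativeFlip_body_of_two_pow_le ValuativeBound_proof (n := n) (2 ^ n - 1) (by omega) U r hU δ lam hcard
    exact absurd hlt (not_lt.mpr hle)
  have hmin : ∀ m' < m₁, n ≤ m' → ∃ (_ : NeZero m'), (∃ (U : Submodule ℂ (MatIdx m' → ℂ)) (r δ : ℕ) (lam : Nat.Partition (m' * δ)), (∀ u ∈ U, (Matrix.of fun a b : Fin m' => u (toLex (a, b))).rank ≤ r) ∧ lam.parts.card ≤ m' * m' ∧ Module.finrank ℂ ↥(MvPolynomial.homogeneousSubmodule (MatIdx m' × MatIdx m') ℂ (m' * δ) ⊓ ((MvPolynomial.vanishingIdeal ℂ {p : MatIdx m' × MatIdx m' → ℂ | ∀ j : MatIdx m', (fun i => p (j, i)) ∈ U}) ^ (δ *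 (m' - r))).restrictScalars ℂ ⊓
            (⨅ (M : Matrix (MatIdx m') (MatIdx m') ℂ) (_ : linSubst (MatIdx m') ℂ M (detFormLex ℂ m') = detFormLex ℂ m'), LinearMap.ker ((MvPolynomial.aeval fun p : MatIdx m' × MatIdx m' => ∑ l : MatIdx m', M l p.2 • (MvPolynomial.X (p.1, l) : MvPolynomial (MatIdx m' × MatIdx m') ℂ)).toLinearMap - (LinearMap.id : MvPolynomial (MatIdx m' × MatIdx m') ℂ →ₗ[ℂ] MvPolynomial (MatIdx m' × MatIdx m') ℂ))) ⊓
            (⨅ (g : Matrix.GeneralLinearGroup (MatIdx m') ℂ) (_ : IsUpperTriangular g), LinearMap.ker ((MvPolynomial.aeval fun p : MatIdx m' × MatIdx m' => ∑ l : MatIdx m', ((g⁻¹ : Matrix.GeneralLinearGroup (MatIdx m') ℂ) : Matrix (MatIdx m') (MatIdx m') ℂ) p.1 l • (MvPolynomial.X (l, p.2) : MvPolynomial (MatIdx m' × MatIdx m') ℂ)).toLinearMap - weightChar ((Weight.dualOfPartition (m' * m') lam).toMatIdx : Weight (MatIdx m')) g • (LinearMap.id : MvPolynomial (MatIdx m'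 × MatIdx m') ℂ →ₗ[ℂ] MvPolynomial (MatIdx m' × MatIdx m') ℂ))))
          < orbitMultiplicity ℂ (paddedPerFormLex ℂ n m') m' ((Weight.dualOfPartition (m' * m') lam).toMatIdx : Weight (MatIdx m'))) := by
    intro m' hm' hnm'
    by_contra hno
    exact Nat.find_min hex hm' ⟨hnm', hno⟩
  -- `m₁ ≠ n`: the bottom flips
  have hm₁n : n + 1 ≤ m₁ := by
    rcases Nat.lt_or_ge n m₁ with h | h
    · omega
    · exfalso
      have heq : m₁ = n := le_antisymm h hm₁.1
      haveI : NeZero n := ⟨by omega⟩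
      apply hm₁.2
      rw [heq]
      exact ⟨inferInstance, valuativeFlip_cruxBody_bottom n hn3⟩
  -- `m₁` is beyond the slope-`a/b` head: otherwise it would flip
  have hslope : a * n < b * m₁ := by
    by_contra hle
    rw [not_lt] at hle
    haveI : NeZero m₁ := ⟨by omega⟩
    exact hm₁.2 ⟨inferInstance, hn₁ n hnn₁ m₁ hm₁.1 hle⟩
  clear_value m₁
  obtain ⟨m, rfl⟩ : ∃ m, m₁ = m + 1 := ⟨m₁ - 1, by omega⟩
  obtain ⟨inst, hflip⟩ := hmin m (Nat.lt_succ_self m) (by omega)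
  refine ⟨m, inst, by omega, by omega, hslope, hflip, ?_⟩
  intro hb'
  exact hm₁.2 ⟨⟨by omega⟩, hb'⟩

/-- **No uniform step transfer even on the tail range.**  For `n ≥ 32` it is false that the flip body
passes from `m` to `m + 1` at every level of the TAIL range `2n² < (m + 14)²`, `m + 2 ≤ 2ⁿ`: the break of
`exists_stepBreak_above_sqrt2` lies there.  (Sharpens `not_uniform_succTransfer`, whose break might a priori
have been inside the head; after `HeadFlip` it cannot.)  Any `m ↦ m + 1` principle for the tail must therefore
use the quasi-polynomial ceiling of the window, cf. `valuativeFlip_iff_windowStepTransfer`. [this file; new] -/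
theorem not_stepTransfer_on_tail_range (n : ℕ) (hn : 32 ≤ n) :
    ¬ ∀ (m : ℕ) [NeZero m], n ≤ m → 2 * n ^ 2 < (m + 14) ^ 2 → m + 2 ≤ 2 ^ n →
      (∃ (U : Submodule ℂ (MatIdx m → ℂ)) (r δ : ℕ) (lam : Nat.Partition (m * δ)), (∀ u ∈ U, (Matrix.of fun a b : Fin m => u (toLex (a, b))).rank ≤ r) ∧ lam.parts.card ≤ m * m ∧ Module.finrank ℂ ↥(MvPolynomial.homogeneousSubmodule (MatIdx m × MatIdx m) ℂ (m * δ) ⊓ ((MvPolynomial.vanishingIdeal ℂ {p : MatIdx m × MatIdx m → ℂ | ∀ j : MatIdx m, (fun i => p (j, i)) ∈ U}) ^ (δ * (m - r))).restrictScalars ℂ ⊓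
            (⨅ (M : Matrix (MatIdx m) (MatIdx m) ℂ) (_ : linSubst (MatIdx m) ℂ M (detFormLex ℂ m) = detFormLex ℂ m), LinearMap.ker ((MvPolynomial.aeval fun p : MatIdx m × MatIdx m => ∑ l : MatIdx m, M l p.2 • (MvPolynomial.X (p.1, l) : MvPolynomial (MatIdx m × MatIdx m) ℂ)).toLinearMap - (LinearMap.id : MvPolynomial (MatIdx m × MatIdx m) ℂ →ₗ[ℂ] MvPolynomial (MatIdx m × MatIdx m) ℂ))) ⊓
            (⨅ (g : Matrix.GeneralLinearGroup (MatIdx m) ℂ) (_ : IsUpperTriangular g), LinearMap.ker ((MvPolynomial.aeval fun p : MatIdx m × MatIdx m => ∑ l : MatIdx m, ((g⁻¹ : Matrix.GeneralLinearGroup (MatIdx m) ℂ) : Matrix (MatIdx m) (MatIdx m) ℂ) p.1 l • (MvPolynomial.X (l, p.2) : MvPolynomial (MatIdx m × MatIdx m) ℂ)).toLinearMap - weightChar ((Weight.dualOfPartition (m * m) lam).toMatIdx : Weight (MatIdx m)) g • (LinearMap.id : MvPolynomial (MatIdx m × MatIdx m) ℂ →ₗ[ℂ] MvPolynomial (MatIdx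 m × MatIdx m) ℂ))))
          < orbitMultiplicity ℂ (paddedPerFormLex ℂ n m) m ((Weight.dualOfPartition (m * m) lam).toMatIdx : Weight (MatIdx m))) →
      (∃ (U : Submodule ℂ (MatIdx (m + 1) → ℂ)) (r δ : ℕ) (lam : Nat.Partition ((m + 1) * δ)), (∀ u ∈ U, (Matrix.of fun a b : Fin (m + 1) => u (toLex (a, b))).rank ≤ r) ∧ lam.parts.card ≤ (m + 1) * (m + 1) ∧ Module.finrank ℂ ↥(MvPolynomial.homogeneousSubmodule (MatIdx (m + 1) × MatIdx (m + 1)) ℂ ((m + 1) * δ) ⊓ ((MvPolynomial.vanishingIdeal ℂ {p : MatIdx (m + 1) × MatIdx (m + 1) → ℂ | ∀ j : MatIdx (m + 1), (fun i => p (j, i)) ∈ U}) ^ (δ * ((m + 1) - r))).restrictScalars ℂ ⊓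
            (⨅ (M : Matrix (MatIdx (m + 1)) (MatIdx (m + 1)) ℂ) (_ : linSubst (MatIdx (m + 1)) ℂ M (detFormLex ℂ (m + 1)) = detFormLex ℂ (m + 1)), LinearMap.ker ((MvPolynomial.aeval fun p : MatIdx (m + 1) × MatIdx (m + 1) => ∑ l : MatIdx (m + 1), M l p.2 • (MvPolynomial.X (p.1, l) : MvPolynomial (MatIdx (m + 1) × MatIdx (m + 1)) ℂ)).toLinearMap - (LinearMap.id : MvPolynomial (MatIdx (m + 1) × MatIdx (m + 1)) ℂ →ₗ[ℂ] MvPolynomial (MatIdx (m + 1) × MatIdx (m + 1)) ℂ))) ⊓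
            (⨅ (g : Matrix.GeneralLinearGroup (MatIdx (m + 1)) ℂ) (_ : IsUpperTriangular g), LinearMap.ker ((MvPolynomial.aeval fun p : MatIdx (m + 1) × MatIdx (m + 1) => ∑ l : MatIdx (m + 1), ((g⁻¹ : Matrix.GeneralLinearGroup (MatIdx (m + 1)) ℂ) : Matrix (MatIdx (m + 1)) (MatIdx (m + 1)) ℂ) p.1 l • (MvPolynomial.X (l, p.2) : MvPolynomial (MatIdx (m + 1) × MatIdx (m + 1)) ℂ)).toLinearMap - weightChar ((Weight.dualOfPartition ((m + 1) * (m + 1)) lam).toMatIdx : Weight (MatIdx (m + 1))) g • (LinearMap.id : MvPolynomial (MatIdx (m + 1) × MatIdx (m + 1)) ℂ →ₗ[ℂ] MvPolynomial (MatIdx (m + 1) × MatIdx (m + 1)) ℂ))))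
          < orbitMultiplicity ℂ (paddedPerFormLex ℂ n (m + 1)) (m + 1) ((Weight.dualOfPartition ((m + 1) * (m + 1)) lam).toMatIdx : Weight (MatIdx (m + 1)))) := by
  intro H
  obtain ⟨m, inst, hnm, hm2, hsq, hflip, hno⟩ := exists_stepBreak_above_sqrt2 n hn
  exact hno (H m hnm hsq hm2 hflip)

end

end Summit.ValiantsHypothesis.ValiantsHypothesis.Theorems.ValuativeFlip
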